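import Literature.NumberTheory.Transcendental.RoyRankGenericConditions
import HarnessLib

/-!
# Roy 1992 over a general field: Theorem 4 PROVED from Theorem 2

Final file of the field-generic deduction of Roy's Theorem 4 (`RoyRank.Thm4 F L`) from his
Theorem 2 (`RoyRank.Thm2 F L ω`) over the data `(K, F, L, ω)` of
`Literature.NumberTheory.Transcendental.RoyRankGenericDefs` ([Roy1992], §4 pp. 34–37, in the
generality of Remark (i) p. 37: "Let `F` be a subfield of `ℚ̄`. Theorem 4 remains valid if we
substitute everywhere in its statement `F` to `ℚ̄` and `F + F·L` to `𝓛̃`. The proof is the same"),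
on top of the support files `…RoyRankGenericMaps`, `…Phi`, `…Conditions`; it is the field-generic
form of the tree's `K = ℂ` companion
`Literature.Barriers.Schanuel.AlgebraicIndependenceOfLogarithmsThm4FromThm2`
(`roy1992_thm4_of_thm2`). The only hypothesis on the data is that `F` be algebraic over `ℚ`
(`hF`, Roy's "subfield of `ℚ̄`"), used to produce the number field `k` of p. 35; `ω` is arbitrary
(the proof uses only the left inequality of Theorem 2, in which `Ω` does not appear).

## The printed proof (pp. 34–37) and its rendering

"By induction on `d` … If `d' < d`, this allows us … to assume the theorem true for the triple
`(d', Z', U')`. The choice of the application `t` attached to `(d, Z, U)` justifies the right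
inequality in (1). Also, it allows us to choose the identity mapping of `K^{d'}` in applying the
theorem to `(d', Z', U')`, and this gives the left inequality in (1) if `d' < d`. This brings us to
proving the theorem in the case `d' = d`. In this case, `t` is an isomorphism … Therefore, `U`
satisfies (2) … From this, we shall deduce (3) `dim_ℚ̄(Z)/(d + dim_ℚ̄(Z)) ≤ dim_K(U)/d`. It is
clear if `U = K^d`. We thus suppose `U ≠ K^d`" — `RoyRank.thm4_of_thm2` (the induction) and
`RoyRank.core` ((2) ⇒ (3)). For (3): the number field `k ⊆ F`, the basis `η`, the map `φ`,
`W = φ⁻¹(0)`, `V = φ⁻¹(U)` (support files), and "Theorem 2 applies to the family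
`(K^d × (K^d)^m, Y, W, V)` … If for `s` the identity mapping of `K^d × (K^d)^m` is chosen, Theorem 2
gives `(md + dim_ℚ(Y))/(d + md − dim_K(W)) ≤ md/(d + md − dim_K(V))` … Making use of (6), we then
get `(d + dim_ℚ̄(Z))/d ≤ d/(d − dim_K(U))`, from which the inequality (3) follows" (p. 37), the
legitimacy of the identity being conditions (4) and (5) of `…Conditions`. As in the `K = ℂ` file,
`Y` is the `ℚ`-span of chosen `φ`-preimages in `k^d × L^{md}` of the `mn` vectors `η_μ z_r` (`z_r`
an `F`-basis of `Z`), which has all the properties the argument uses (`Y ⊆ F^{d₀} × L^{d₁}`,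
`φ(Y) ⊆ U`, finite-dimensional, `dim_ℚ Y ≥ m dim_F Z`).

## References

* [Roy1992] D. Roy, *Matrices whose coefficients are linear forms in logarithms*, J. Number Theory
  41 (1992) 22–47: §4, Theorem 4 and its proof, pp. 34–37; Remark (i), p. 37.
-/

noncomputable section

open Module Submodule
open Literature.Barriers.Schanuel.Roy1992 (incl incl_apply fPoints mem_fPoints
  finrank_comap_of_surjective)

namespace Literature.NumberTheory.Transcendental.RoyRank

variable {K : Type*} [Field K] [CharZero K]
variable {F : IntermediateField ℚ K} {L : Submodule ℚ K} {ω : K}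
variable {d : ℕ}

/-! ### Small lemmas -/

omit [CharZero K] in
/-- The identity of `K^d`, `d > 0`, is non-zero. [folklore] -/
theorem id_ne_zero (hd : 0 < d) : (LinearMap.id : (Fin d → K) →ₗ[K] (Fin d → K)) ≠ 0 :=
  ne_zero_of_surjective hd Function.surjective_id

/-- A `ℚ`-subspace of `k^d × L^{md}` (`k ⊆ F`) is contained in `F^{d₀} × L^{d₁}`. [folklore] -/
theorem isFLogSubspace_of_le {m : ℕ} {k : IntermediateField ℚ K} (hkF : k ≤ F)
    {Y : Submodule ℚ (LinTangent K d (m * d))} (hY : Y ≤ goodSubspace L d m k) :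
    IsFLogSubspace F L Y := by
  intro y hy
  obtain ⟨h1, h2⟩ := mem_goodSubspace.1 (hY hy)
  exact ⟨fun i => hkF (h1 i), fun j => h2 j⟩

/-! ### (2) ⇒ (3): the heart of the case `d' = d` -/

/-- **Roy's (2) ⇒ (3)** (the case `d' = d` of Theorem 4, given Theorem 2): if `U ⊆ K^d` (`d > 0`)
contains the finite-dimensional `F`-subspace `Z ⊆ (F + F·L)^d` and satisfies the minimality (2),
then `dim_F(Z)/(d + dim_F(Z)) ≤ dim_K(U)/d` (3). Proof as on pp. 35–37, applying `Thm2 F L ω` to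
`(K^d × (K^d)^m, Y, W = ker φ, V = φ⁻¹(U))` with the identity, legitimate by (4)
(`fPoints_eq_bot_of_minimal`) and (5) (`thm2Ratio_id_le`); `F` algebraic over `ℚ` (`hF`).
[cite: Roy1992, §4 proof of Theorem 4, (2)–(3) and pp. 35–37] -/
theorem core (h2 : Thm2 F L ω) (hF : ∀ x : K, x ∈ F → IsAlgebraic ℚ x) (hd : 0 < d)
    (Z : Submodule F (Fin d → K)) (U : Submodule K (Fin d → K)) [Module.Finite F Z]
    (hZ : ∀ z ∈ Z, ∀ i, z i ∈ linForms F L) (hZU : Z ≤ U.restrictScalars F)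
    (hmin : IsMinimalTwo F d U) :
    (finrank F Z : ℝ) / (d + finrank F Z) ≤ (finrank K U : ℝ) / d := by
  have hdR : (0 : ℝ) < d := by exact_mod_cast hd
  have hn0 : (0 : ℝ) ≤ finrank F Z := by positivity
  by_cases hU : U = ⊤
  · rw [hU, finrank_top, finrank_fin_fun, div_self hdR.ne']
    rw [div_le_one (by linarith)]
    linarith
  -- the number field, its basis, the vectors `η_μ z_r` and their `φ`-preimages
  obtain ⟨k, hk, hkF, b₀, hb₀⟩ := exists_numberField_basis F L hF Z hZ
  haveI := hk
  -- opaque dimensions `m = [k : ℚ]`, `n = dim_F Z` (keeps `finrank` out of the types)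
  obtain ⟨m, η, hmk⟩ : ∃ (m : ℕ) (η : Basis (Fin m) ℚ k), finrank ℚ k = m :=
    ⟨finrank ℚ k, Module.finBasis ℚ k, rfl⟩
  obtain ⟨n, b, hb, hnZ⟩ : ∃ (n : ℕ) (b : Basis (Fin n) F Z),
      (∀ r i, (b r : Fin d → K) i ∈ Submodule.span k ({1} ∪ (L : Set K))) ∧
      finrank F Z = n := ⟨_, b₀, hb₀, rfl⟩
  have hz : LinearIndependent F (fun r => (b r : Fin d → K)) :=
    b.linearIndependent.map' Z.subtype Z.ker_subtype
  have hpre : ∀ p : Fin m × Fin n, ∃ q : LinTangent K d (m * d),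
      phi η q = ((η p.1 : k) : K) • (b p.2 : Fin d → K) ∧ (∀ i, q.1 i ∈ k) ∧ ∀ j, q.2 j ∈ L :=
    fun p => exists_phi_preimage η L fun i => by
      have h : (((η p.1 : k) : K) • (b p.2 : Fin d → K)) i = (η p.1 : k) • ((b p.2 : Fin d → K) i) := by
        rw [Pi.smul_apply, IntermediateField.smul_def]
      rw [h]
      exact Submodule.smul_mem _ _ (hb p.2 i)
  choose q hq hq1 hq2 using hpre
  set Y : Submodule ℚ (LinTangent K d (m * d)) := Submodule.span ℚ (Set.range q) with hYdef
  have hYli : LinearIndependent ℚ q := by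
    refine LinearIndependent.of_comp ((phi η).restrictScalars ℚ) ?_
    have hcomp : ⇑((phi η).restrictScalars ℚ) ∘ q =
        fun p => ((η p.1 : k) : K) • (b p.2 : Fin d → K) := funext hq
    rw [hcomp]
    exact linearIndependent_eta_smul (z := fun r => (b r : Fin d → K)) η hkF hz
  have hYfin : FiniteDimensional ℚ Y := FiniteDimensional.span_of_finite ℚ (Set.finite_range q)
  have hYrank : finrank ℚ Y = m * n := by
    rw [hYdef, finrank_span_eq_card hYli, Fintype.card_prod, Fintype.card_fin, Fintype.card_fin]
  have hYgood : Y ≤ goodSubspace L d m k := by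
    rw [hYdef, Submodule.span_le]
    rintro _ ⟨p, rfl⟩
    exact mem_goodSubspace.2 ⟨hq1 p, hq2 p⟩
  have hYlog : IsFLogSubspace F L Y := isFLogSubspace_of_le hkF hYgood
  -- `W = ker φ`, `V = φ⁻¹(U)`
  have hW : IsFRational F (LinearMap.ker (phi (d := d) η)) := isFRational_ker_phi (d := d) η hkF
  set V : Submodule K (LinTangent K d (m * d)) := U.comap (phi η) with hVdef
  have hYV : Y ≤ V.restrictScalars ℚ := by
    rw [hYdef, Submodule.span_le]
    rintro _ ⟨p, rfl⟩
    rw [SetLike.mem_coe, Submodule.restrictScalars_mem, hVdef, Submodule.mem_comap, hq]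
    exact U.smul_mem _ (hZU (b p.2).2)
  have hWV : LinearMap.ker (phi η) ≤ V := by
    rw [hVdef, ← Submodule.comap_bot]
    exact Submodule.comap_mono bot_le
  have hV : V ≠ ⊤ := by
    intro h
    apply hU
    rw [← Submodule.map_comap_eq_of_surjective (phi_surjective η) U, ← hVdef, h, Submodule.map_top,
      LinearMap.range_eq_top.2 (phi_surjective η)]
  -- Theorem 2, with the identity
  obtain ⟨-, hall⟩ := h2 d (m * d) Y (LinearMap.ker (phi η)) V hYfin hYlog hW hYV hWV hV
  have hminId : IsThm2Minimal F V d (m * d) LinearMap.id :=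
    ⟨isAdmissible_id F _ _, by rwa [Submodule.map_id],
      fun d₀' d₁' s hs hsV => thm2Ratio_id_le η hkF hd hU hmin s hs hsV⟩
  have h4 : ∀ v ∈ V.map LinearMap.id, (∀ i, v.1 i ∈ F) → v.2 = 0 → v = 0 := by
    intro v hv hv1 hv2
    rw [Submodule.map_id, hVdef, Submodule.mem_comap, phi_apply, hv2, map_zero, add_zero] at hv
    let v₀ : Fin d → F := fun i => ⟨v.1 i, hv1 i⟩
    have hv₀ : incl F K d v₀ = v.1 := funext fun i => rfl
    have hmem : v₀ ∈ fPoints (F := F) U := by rw [mem_fPoints, hv₀]; exact hv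
    rw [fPoints_eq_bot_of_minimal hd hU hmin, Submodule.mem_bot] at hmem
    refine Prod.ext ?_ hv2
    rw [← hv₀, hmem, map_zero]
    rfl
  obtain ⟨hineq, -⟩ := hall d (m * d) LinearMap.id hminId h4
  -- read off the numbers
  have hidQ : ((LinearMap.id : LinTangent K d (m * d) →ₗ[K] _).restrictScalars ℚ) = LinearMap.id :=
    rfl
  have hVfin : finrank K V = finrank K U + m * d := by
    rw [hVdef, finrank_comap_of_surjective _ (phi_surjective η), finrank_ker_phi]
  have hu : finrank K U < d := by
    have h := Submodule.finrank_lt hU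
    rw [finrank_fin_fun] at h
    exact h
  have hmpos : 0 < m := hmk ▸ finrank_pos
  rw [hidQ, Submodule.map_id, Submodule.map_id, hYrank, finrank_ker_phi, thm2Ratio, Submodule.map_id,
    hVfin] at hineq
  rw [hnZ]
  exact core_arith hd hu hmpos hineq
where
  /-- The arithmetic of p. 37: from `(md + mn)/(d + md − md) ≤ md/(d + md − (u + md))` with
  `0 < d`, `u < d`, `0 < m` follows `n/(d + n) ≤ u/d`. [cite: Roy1992, §4 proof of Theorem 4 (p. 37)] -/
  core_arith {dd u m n : ℕ} (hd : 0 < dd) (hu : u < dd) (hmpos : 0 < m)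
      (hineq : ((m * dd : ℕ) + ((m * n : ℕ) : ℝ)) / ((dd : ℝ) + (m * dd : ℕ) - ((m * dd : ℕ) : ℝ)) ≤
        ((m * dd : ℕ) : ℝ) / ((dd : ℝ) + (m * dd : ℕ) - ((u + m * dd : ℕ) : ℝ))) :
      (n : ℝ) / (dd + n) ≤ (u : ℝ) / dd := by
    have hdR : (0 : ℝ) < dd := by exact_mod_cast hd
    have huR : (u : ℝ) < dd := by exact_mod_cast hu
    have hmR : (0 : ℝ) < m := by exact_mod_cast hmpos
    have hn0 : (0 : ℝ) ≤ n := by positivity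
    have hineq' : (((m * dd : ℕ) : ℝ) + ((m * n : ℕ) : ℝ)) / dd ≤ ((m * dd : ℕ) : ℝ) / (dd - u) := by
      have e1 : (dd : ℝ) + ((m * dd : ℕ) : ℝ) - ((m * dd : ℕ) : ℝ) = dd := by ring
      have e2 : (dd : ℝ) + ((m * dd : ℕ) : ℝ) - ((u + m * dd : ℕ) : ℝ) = dd - u := by push_cast; ring
      rw [e1, e2] at hineq
      exact hineq
    rw [div_le_div_iff₀ hdR (by linarith)] at hineq'
    rw [div_le_div_iff₀ (by linarith) hdR]
    push_cast at hineq'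
    nlinarith [mul_pos hmR hdR, hineq']

/-! ### The induction on `d` -/

/-- **Theorem 4 from Theorem 2 over the data `(K, F, L, ω)`** (`F` algebraic over `ℚ`): the
induction on `d` of p. 34 around `RoyRank.core`. For `K = ℂ`, `F = ℚ̄` this is the tree's
`roy1992_thm4_of_thm2`; the `p`-adic instance `K = ℚ̄_p` is drawn in a companion.
[cite: Roy1992, §4 Theorem 4 and its proof (pp. 34–37); Remark (i) (p. 37)] -/
theorem thm4_of_thm2 (h2 : Thm2 F L ω) (hF : ∀ x : K, x ∈ F → IsAlgebraic ℚ x) : Thm4 F L := by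
  intro d
  induction d using Nat.strong_induction_on with
  | _ d ih =>
  intro hd Z U hZfin hZ hZU d' t ht hrat hne hmin
  haveI := hZfin
  -- the right inequality: minimality against the identity
  have hR : (finrank K (U.map t) : ℝ) / d' ≤ (finrank K U : ℝ) / d := by
    have := hmin d LinearMap.id Function.surjective_id (isRationalMap_id F d) (id_ne_zero hd)
    rwa [Submodule.map_id] at this
  refine ⟨?_, hR⟩
  have hd'le : d' ≤ d := by simpa using LinearMap.finrank_le_finrank_of_surjective ht
  have hd'pos : 0 < d' := pos_of_ne_zero hne
  rcases hd'le.lt_or_eq with hlt | heq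
  · -- `d' < d`: the induction hypothesis for `(d', Z', U')` and the identity
    obtain ⟨A, rfl⟩ := exists_eq_mulVecLin_of_isRationalMap F hrat
    have hZ' : ∀ z ∈ Z.map (((A.map (algebraMap F K)).mulVecLin).restrictScalars F), ∀ i,
        z i ∈ linForms F L := by
      rintro _ ⟨z, hz, rfl⟩ i
      exact mulVec_map_mem_linForms F L A (hZ z hz) i
    have hZ'U' : Z.map (((A.map (algebraMap F K)).mulVecLin).restrictScalars F) ≤
        (U.map (A.map (algebraMap F K)).mulVecLin).restrictScalars F := by
      rintro _ ⟨z, hz, rfl⟩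
      exact Submodule.mem_map_of_mem (hZU hz)
    have hmin' : ∀ (d'' : ℕ) (t'' : (Fin d' → K) →ₗ[K] (Fin d'' → K)), Function.Surjective t'' →
        IsRationalMap F t'' → t'' ≠ 0 →
        (finrank K ((U.map (A.map (algebraMap F K)).mulVecLin).map LinearMap.id) : ℝ) / d' ≤
          (finrank K ((U.map (A.map (algebraMap F K)).mulVecLin).map t'') : ℝ) / d'' := by
      intro d'' t'' ht'' hrat'' hne''
      rw [Submodule.map_id, ← Submodule.map_comp]
      refine hmin d'' (t'' ∘ₗ (A.map (algebraMap F K)).mulVecLin) (ht''.comp ht)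
        (isRationalMap_comp F hrat hrat'') ?_
      intro h0
      apply hne''
      refine LinearMap.ext fun w => ?_
      obtain ⟨v, rfl⟩ := ht w
      exact congrArg (fun f => f v) (congrArg DFunLike.coe h0)
    have hIH := (ih d' hlt hd'pos _ _ inferInstance hZ' hZ'U' d' LinearMap.id Function.surjective_id
      (isRationalMap_id F d') (id_ne_zero hd'pos) hmin').1
    have hidQ : ((LinearMap.id : (Fin d' → K) →ₗ[K] (Fin d' → K)).restrictScalars F) =
        LinearMap.id := rfl
    rwa [hidQ, Submodule.map_id, Submodule.map_id] at hIH
  · -- `d' = d`: `t` is an isomorphism and `U` satisfies (2)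
    subst heq
    have htinj : Function.Injective t := LinearMap.injective_iff_surjective.2 ht
    have hUt : finrank K (U.map t) = finrank K U :=
      (LinearEquiv.finrank_eq (Submodule.equivMapOfInjective t htinj U)).symm
    have hZt : finrank F (Z.map (t.restrictScalars F)) = finrank F Z :=
      (LinearEquiv.finrank_eq (Submodule.equivMapOfInjective (t.restrictScalars F) htinj Z)).symm
    rw [hUt, hZt]
    refine core h2 hF hd Z U hZ hZU fun d₁ t₁ ht₁ hrat₁ hne₁ => ?_
    have := hmin d₁ t₁ ht₁ hrat₁ hne₁
    rwa [hUt] at this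

end Literature.NumberTheory.Transcendental.RoyRank
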